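import Summits.Ventures.PercRepro.CoreRegimesLemmas

/-!
# PercRepro — the regime A / B′ inequalities of the `q = 3` counting programme, for every `p ≥ 201` (p2, gen 11)

Night-1's counting route to C-025 at `q = 3` (`proofs/NIGHT-1-C025-induction.md` §12–§13) reduces, on the core
(simple, coloop-free, rank `p`, every element with an `e`-free partition, hence lines `≤ 3` points and planes
`≤ 7` points), the inequality `Φ(p,3)·#U ≤ #Y` to one of two PURELY ARITHMETIC inequalities in `n = p + d`
(`d` = corank), `ρ = 64/35` (the plane-catalogue constant), `Φ = Φ(p,3) = phiK p 3`:

* regime A (`6 ≤ d ≤ 3p + 2`):  `Φ·((2+ρ)·C(n,3) + n²) + Σ_{j≤3} C(n,j) + (1+ρ)·C(n,3) + n² + Σ_{j≤d} C(n,j) ≤ 2ⁿ`;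
* regime B′ (`d ≥ 3p − 1`):     `Φ·((2+ρ)·C(n,3) + n²) + Σ_{j≤3} C(n,j) + (1+ρ)·C(n,3) + n² ≤ Σ_{u=4}^{p−1} C(n,u)`

(the objects of `mining/night-1/g1/core_regimes_big.py` verbatim). Night-1 verified them by exact arithmetic for
`p ≤ 200` (residue (R3) of §13.4: «the general-`p` argument is the displayed asymptotic, not a formal proof»).
This file is the kernel form of `proofs/P2-R3.md` (THEOREM R3): both inequalities hold for EVERY `p ≥ 201`, with
explicit constants and no asymptotics — `regimeA_of_le`, `regimeB_of_le`, `regime_of_six_le`. Pure binomial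
arithmetic over `ℕ` / `ℚ` (lemmas in `CoreRegimesLemmas.lean`); no matroid enters.

* `rhoCore`, `Ubound`, `Rbound`, `lhsU`, `RegimeA`, `RegimeB` — the objects of §13.3 / `core_regimes_big.py`;
* `alphaP = 811/210`, `lhsU_le`: `L ≤ α′·Φ·C(n,3) + 4·C(n,3)` for `n ≥ 183`; `phiK_mul_choose_mul_le`:
  `Φ·C(n,3)·(p+1)³ ≤ 2^{p+3}·n³`; `sum_range_choose_eq_sub` (the complement identity in `ℚ`);
  `choose_three_le_two_pow_div`, `sum_range_choose_le_two_pow_div` (polynomial tails against `2ⁿ`);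
* `regimeA_of_le_nine` (case A1, `6 ≤ d ≤ 9`, the tight case: `L + tail ≤ 0.544·2ⁿ`), `regimeA_of_le_sub_two`
  (case A2, `10 ≤ d ≤ p − 2`: `L < 2^{n−1} ≤ Σ_{i<p} C(n,i)`), `regimeA_of_le_three_mul` (case A3, `p − 1 ≤ d ≤ 3p + 2`:
  `L ≤ 2^{2p−3} ≤ Σ_{i<p} C(2p−2,i)`), `regimeB_of_le` (`d ≥ 3p − 1`: `L ≤ 2^{p+6}·C(n,3) ≤ 3^{p−4}·C(n,3) ≤ C(n,p−1)`);
* **`regimeA_of_le`** (THEOREM R3 (A)), **`regimeB_of_le`** (THEOREM R3 (B′)), **`regime_of_six_le`** (every `p ≥ 201`,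
  every `d ≥ 6`: regime A or regime B′).
-/

namespace PercRepro
namespace CoreRegimes

open Finset

/-- `ρ = 64/35`: the catalogue constant of NIGHT-1 §12 (the maximum of `#cyclic rank-3 subsets / #rank-3 triples`
over the simple planes with `≤ 7` points and lines `≤ 3` points, attained by `U_{3,7}`). -/
def rhoCore : ℚ := 64 / 35

/-- `U(n) = (2+ρ)·C(n,3) + n²` — night-1's bound on `#U(p,3)` on the core (§12: `#U ≤ W₃ ≤ (2+ρ)C(n,3) + n²`). -/
def Ubound (n : ℕ) : ℚ := (2 + rhoCore) * (Nat.choose n 3 : ℚ) + (n : ℚ) ^ 2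

/-- `R₃(n) = Σ_{j≤3} C(n,j) + (1+ρ)·C(n,3) + n²` — night-1's bound on `#{r ≤ 3}` on the core. -/
def Rbound (n : ℕ) : ℚ :=
  (∑ j ∈ range 4, (Nat.choose n j : ℚ)) + (1 + rhoCore) * (Nat.choose n 3 : ℚ) + (n : ℚ) ^ 2

/-- `L(p,d) = Φ(p,3)·U(p+d) + R₃(p+d)` — the `lhsU` of `core_regimes_big.py`. -/
def lhsU (p d : ℕ) : ℚ := phiK p 3 * Ubound (p + d) + Rbound (p + d)

/-- Regime A at `(p, d)`: `L(p,d) + Σ_{j≤d} C(p+d, j) ≤ 2^{p+d}`. -/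
def RegimeA (p d : ℕ) : Prop :=
  lhsU p d + ∑ j ∈ range (d + 1), (Nat.choose (p + d) j : ℚ) ≤ (2 : ℚ) ^ (p + d)

/-- Regime B′ at `(p, d)`: `L(p,d) ≤ Σ_{u=4}^{p−1} C(p+d, u)`. -/
def RegimeB (p d : ℕ) : Prop :=
  lhsU p d ≤ ∑ u ∈ Ico 4 p, (Nat.choose (p + d) u : ℚ)


/-- `α′ = 811/210 = 2 + ρ + 1/30`: the constant absorbing `n²` into `C(n,3)` (`30·n² ≤ C(n,3)` for `n ≥ 183`). -/
def alphaP : ℚ := 811 / 210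

/-- For `n = p + d ≥ 183`: `L(p,d) ≤ α′·Φ(p,3)·C(n,3) + 4·C(n,3)` (the polynomial terms are absorbed). -/
theorem lhsU_le (p d : ℕ) (hn : 183 ≤ p + d) :
    lhsU p d ≤ alphaP * (phiK p 3 * (Nat.choose (p + d) 3 : ℚ)) + 4 * (Nat.choose (p + d) 3 : ℚ) := by
  have hC : (30 * ((p + d : ℕ) : ℚ) ^ 2) ≤ (Nat.choose (p + d) 3 : ℚ) := by
    exact_mod_cast choose_three_ge_thirty_sq (p + d) hn
  have hC2 : (Nat.choose (p + d) 2 : ℚ) ≤ ((p + d : ℕ) : ℚ) ^ 2 := by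
    exact_mod_cast Nat.choose_le_pow (p + d) 2
  have hn1 : (1 : ℚ) ≤ ((p + d : ℕ) : ℚ) := by exact_mod_cast (show 1 ≤ p + d by omega)
  have hsum : (∑ j ∈ range 4, (Nat.choose (p + d) j : ℚ))
      = 1 + ((p + d : ℕ) : ℚ) + (Nat.choose (p + d) 2 : ℚ) + (Nat.choose (p + d) 3 : ℚ) := by
    simp [Finset.sum_range_succ]
  have hphi := phiK_three_nonneg p
  have hPn : phiK p 3 * ((p + d : ℕ) : ℚ) ^ 2 ≤ phiK p 3 * ((Nat.choose (p + d) 3 : ℚ) / 30) := by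
    apply mul_le_mul_of_nonneg_left _ hphi
    linarith
  have expand : lhsU p d = (2 + 64 / 35) * (phiK p 3 * (Nat.choose (p + d) 3 : ℚ))
      + phiK p 3 * ((p + d : ℕ) : ℚ) ^ 2
      + (1 + ((p + d : ℕ) : ℚ) + (Nat.choose (p + d) 2 : ℚ) + (Nat.choose (p + d) 3 : ℚ))
      + (1 + 64 / 35) * (Nat.choose (p + d) 3 : ℚ) + ((p + d : ℕ) : ℚ) ^ 2 := by
    unfold lhsU Ubound Rbound rhoCore
    rw [hsum]
    ring
  rw [expand]
  unfold alphaP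
  nlinarith [hPn, hC, hC2, hn1]

/-- `Φ(p,3)·C(n,3)·(p+1)³ ≤ 2^{p+3}·n³` (Lemmas 1 and 2 combined). -/
theorem phiK_mul_choose_mul_le (p n : ℕ) :
    phiK p 3 * (Nat.choose n 3 : ℚ) * ((p : ℚ) + 1) ^ 3 ≤ (2 : ℚ) ^ (p + 3) * (n : ℚ) ^ 3 := by
  have h1 : (6 * (Nat.choose n 3 : ℚ)) ≤ (n : ℚ) ^ 3 := by exact_mod_cast six_mul_choose_three_le n
  have h2 : ((p : ℚ) + 1) ^ 3 ≤ 6 * (Nat.choose (p + 3) 3 : ℚ) := by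
    exact_mod_cast pow_three_le_six_mul_choose p
  have h3 := phiK_three_mul_choose_le p
  have hphi := phiK_three_nonneg p
  have hCn : (0 : ℚ) ≤ (Nat.choose n 3 : ℚ) := by positivity
  calc phiK p 3 * (Nat.choose n 3 : ℚ) * ((p : ℚ) + 1) ^ 3
      ≤ phiK p 3 * (Nat.choose n 3 : ℚ) * (6 * (Nat.choose (p + 3) 3 : ℚ)) :=
        mul_le_mul_of_nonneg_left h2 (mul_nonneg hphi hCn)
    _ = (phiK p 3 * (Nat.choose (p + 3) 3 : ℚ)) * (6 * (Nat.choose n 3 : ℚ)) := by ring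
    _ ≤ (2 : ℚ) ^ (p + 3) * (n : ℚ) ^ 3 := mul_le_mul h3 h1 (by positivity) (by positivity)

/-- The complement identity in `ℚ`: `Σ_{j≤d} C(p+d,j) = 2^{p+d} − Σ_{i<p} C(p+d,i)`. -/
theorem sum_range_choose_eq_sub (p d : ℕ) :
    (∑ j ∈ range (d + 1), (Nat.choose (p + d) j : ℚ))
      = (2 : ℚ) ^ (p + d) - ∑ i ∈ range p, (Nat.choose (p + d) i : ℚ) := by
  have h := sum_range_choose_add_sum_range_choose p d
  have h' : ((∑ j ∈ range (d + 1), Nat.choose (p + d) j : ℕ) : ℚ)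
      + ((∑ i ∈ range p, Nat.choose (p + d) i : ℕ) : ℚ) = (2 : ℚ) ^ (p + d) := by
    exact_mod_cast h
  push_cast at h'
  linarith

/-- Polynomial tails against `2ⁿ` in `ℚ`, for `n ≥ 207`: `C(n,3) ≤ 2ⁿ/10⁴`. -/
theorem choose_three_le_two_pow_div (n : ℕ) (hn : 207 ≤ n) :
    (Nat.choose n 3 : ℚ) ≤ (2 : ℚ) ^ n / 10000 := by
  have h1 : Nat.choose n 3 ≤ n ^ 9 :=
    (Nat.choose_le_pow n 3).trans (Nat.pow_le_pow_right (by omega) (by norm_num))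
  have h2 := ten_thousand_pow_nine_le_two_pow n hn
  have h3 : 10000 * Nat.choose n 3 ≤ 2 ^ n := by
    calc 10000 * Nat.choose n 3 ≤ 10000 * n ^ 9 := by gcongr
      _ ≤ 2 ^ n := h2
  rw [le_div_iff₀ (by norm_num : (0 : ℚ) < 10000)]
  have : (Nat.choose n 3 : ℚ) * 10000 = ((10000 * Nat.choose n 3 : ℕ) : ℚ) := by push_cast; ring
  rw [this]
  exact_mod_cast h3

/-- Polynomial tails against `2ⁿ` in `ℚ`, for `n ≥ 207`: `Σ_{j≤d} C(n,j) ≤ 2ⁿ/1000` for `d ≤ 9`. -/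
theorem sum_range_choose_le_two_pow_div (n d : ℕ) (hn : 207 ≤ n) (hd : d ≤ 9) :
    (∑ j ∈ range (d + 1), (Nat.choose n j : ℚ)) ≤ (2 : ℚ) ^ n / 1000 := by
  have h1 := sum_range_choose_le_of_le_nine n d hd (by omega)
  have h2 := ten_thousand_pow_nine_le_two_pow n hn
  have h3 : 1000 * ∑ j ∈ range (d + 1), Nat.choose n j ≤ 2 ^ n := by
    calc 1000 * ∑ j ∈ range (d + 1), Nat.choose n j ≤ 1000 * (10 * n ^ 9) := by gcongr
      _ = 10000 * n ^ 9 := by ring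
      _ ≤ 2 ^ n := h2
  rw [le_div_iff₀ (by norm_num : (0 : ℚ) < 1000)]
  have : (∑ j ∈ range (d + 1), (Nat.choose n j : ℚ)) * 1000
      = ((1000 * ∑ j ∈ range (d + 1), Nat.choose n j : ℕ) : ℚ) := by push_cast; ring
  rw [this]
  exact_mod_cast h3

/-! ### Regime A, case A1: `6 ≤ d ≤ 9` (the tight case) -/

/-- Case A1 of THEOREM R3: `RegimeA p d` for `p ≥ 201`, `6 ≤ d ≤ 9`. -/
theorem regimeA_of_le_nine (p d : ℕ) (hp : 201 ≤ p) (hd6 : 6 ≤ d) (hd9 : d ≤ 9) : RegimeA p d := by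
  unfold RegimeA
  have hn207 : 207 ≤ p + d := by omega
  have hL := lhsU_le p d (by omega)
  have hF2 := phiK_mul_choose_mul_le p (p + d)
  -- `101·n ≤ 105·(p+1)`, the only place where `p ≥ 201` enters the ratio
  have hratio : (101 : ℚ) * ((p + d : ℕ) : ℚ) ≤ 105 * ((p : ℚ) + 1) := by
    have : 101 * (p + d) ≤ 105 * (p + 1) := by omega
    exact_mod_cast this
  have hratio3 : (101 : ℚ) ^ 3 * ((p + d : ℕ) : ℚ) ^ 3 ≤ 105 ^ 3 * ((p : ℚ) + 1) ^ 3 := by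
    have h := pow_le_pow_left₀ (by positivity) hratio 3
    calc (101 : ℚ) ^ 3 * ((p + d : ℕ) : ℚ) ^ 3 = (101 * ((p + d : ℕ) : ℚ)) ^ 3 := by ring
      _ ≤ (105 * ((p : ℚ) + 1)) ^ 3 := h
      _ = 105 ^ 3 * ((p : ℚ) + 1) ^ 3 := by ring
  have hpos : (0 : ℚ) < ((p : ℚ) + 1) ^ 3 := by positivity
  -- `Φ·C(n,3) ≤ 2^{p+3}·(105/101)³`
  have hPC : phiK p 3 * (Nat.choose (p + d) 3 : ℚ) ≤ (2 : ℚ) ^ (p + 3) * (105 / 101) ^ 3 := by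
    have h : (phiK p 3 * (Nat.choose (p + d) 3 : ℚ) * 101 ^ 3) * ((p : ℚ) + 1) ^ 3
        ≤ ((2 : ℚ) ^ (p + 3) * 105 ^ 3) * ((p : ℚ) + 1) ^ 3 := by
      calc (phiK p 3 * (Nat.choose (p + d) 3 : ℚ) * 101 ^ 3) * ((p : ℚ) + 1) ^ 3
          = (phiK p 3 * (Nat.choose (p + d) 3 : ℚ) * ((p : ℚ) + 1) ^ 3) * 101 ^ 3 := by ring
        _ ≤ ((2 : ℚ) ^ (p + 3) * ((p + d : ℕ) : ℚ) ^ 3) * 101 ^ 3 := by gcongr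
        _ = (2 : ℚ) ^ (p + 3) * (101 ^ 3 * ((p + d : ℕ) : ℚ) ^ 3) := by ring
        _ ≤ (2 : ℚ) ^ (p + 3) * (105 ^ 3 * ((p : ℚ) + 1) ^ 3) := by gcongr
        _ = ((2 : ℚ) ^ (p + 3) * 105 ^ 3) * ((p : ℚ) + 1) ^ 3 := by ring
    have h' := le_of_mul_le_mul_right h hpos
    have h101 : (0 : ℚ) < 101 ^ 3 := by norm_num
    calc phiK p 3 * (Nat.choose (p + d) 3 : ℚ)
        = (phiK p 3 * (Nat.choose (p + d) 3 : ℚ) * 101 ^ 3) / 101 ^ 3 := by field_simp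
      _ ≤ ((2 : ℚ) ^ (p + 3) * 105 ^ 3) / 101 ^ 3 := by gcongr
      _ = (2 : ℚ) ^ (p + 3) * (105 / 101) ^ 3 := by ring
  have htail := sum_range_choose_le_two_pow_div (p + d) d hn207 hd9
  have hC3 := choose_three_le_two_pow_div (p + d) hn207
  have hY : (2 : ℚ) ^ (p + 3) * 8 ≤ (2 : ℚ) ^ (p + d) := by
    have : (2 : ℚ) ^ (p + 3) * 8 = 2 ^ (p + 6) := by ring
    rw [this]
    exact pow_le_pow_right₀ (by norm_num) (by omega)
  have hc : (811 / 210 : ℚ) * (105 / 101) ^ 3 / 8 + 4 / 10000 + 1 / 1000 ≤ 1 := by norm_num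
  have hphiC : (0 : ℚ) ≤ phiK p 3 * (Nat.choose (p + d) 3 : ℚ) :=
    mul_nonneg (phiK_three_nonneg p) (by positivity)
  unfold alphaP at hL
  nlinarith [hL, hPC, htail, hC3, hY, hc, hphiC]

/-! ### Regime A, case A2: `10 ≤ d ≤ p − 2` -/

/-- Case A2 of THEOREM R3: `RegimeA p d` for `p ≥ 201`, `10 ≤ d`, `d + 2 ≤ p`. -/
theorem regimeA_of_le_sub_two (p d : ℕ) (hp : 201 ≤ p) (hd10 : 10 ≤ d) (hdp : d + 2 ≤ p) :
    RegimeA p d := by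
  unfold RegimeA
  rw [sum_range_choose_eq_sub]
  have hn207 : 207 ≤ p + d := by omega
  have hL := lhsU_le p d (by omega)
  have hF2 := phiK_mul_choose_mul_le p (p + d)
  -- `n ≤ 2(p+1)` so `n³ ≤ 8(p+1)³`
  have hratio : ((p + d : ℕ) : ℚ) ≤ 2 * ((p : ℚ) + 1) := by
    have : p + d ≤ 2 * (p + 1) := by omega
    exact_mod_cast this
  have hratio3 : ((p + d : ℕ) : ℚ) ^ 3 ≤ 8 * ((p : ℚ) + 1) ^ 3 := by
    have h := pow_le_pow_left₀ (by positivity) hratio 3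
    calc ((p + d : ℕ) : ℚ) ^ 3 ≤ (2 * ((p : ℚ) + 1)) ^ 3 := h
      _ = 8 * ((p : ℚ) + 1) ^ 3 := by ring
  have hpos : (0 : ℚ) < ((p : ℚ) + 1) ^ 3 := by positivity
  have hPC : phiK p 3 * (Nat.choose (p + d) 3 : ℚ) ≤ (2 : ℚ) ^ (p + 3) * 8 := by
    have h : (phiK p 3 * (Nat.choose (p + d) 3 : ℚ)) * ((p : ℚ) + 1) ^ 3
        ≤ ((2 : ℚ) ^ (p + 3) * 8) * ((p : ℚ) + 1) ^ 3 := by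
      calc (phiK p 3 * (Nat.choose (p + d) 3 : ℚ)) * ((p : ℚ) + 1) ^ 3
          ≤ (2 : ℚ) ^ (p + 3) * ((p + d : ℕ) : ℚ) ^ 3 := hF2
        _ ≤ (2 : ℚ) ^ (p + 3) * (8 * ((p : ℚ) + 1) ^ 3) := by gcongr
        _ = ((2 : ℚ) ^ (p + 3) * 8) * ((p : ℚ) + 1) ^ 3 := by ring
    exact le_of_mul_le_mul_right h hpos
  have hC3 := choose_three_le_two_pow_div (p + d) hn207
  -- `2^{p+3}·8·16 = 2^{p+10} ≤ 2^{p+d}`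
  have hY : (2 : ℚ) ^ (p + 3) * 8 * 16 ≤ (2 : ℚ) ^ (p + d) := by
    have : (2 : ℚ) ^ (p + 3) * 8 * 16 = 2 ^ (p + 10) := by ring
    rw [this]
    exact pow_le_pow_right₀ (by norm_num) (by omega)
  -- the half sum: `2^{p+d} ≤ 2·Σ_{i<p} C(p+d,i)` since `p + d + 1 ≤ 2p`
  have hhalf : (2 : ℚ) ^ (p + d) ≤ 2 * ∑ i ∈ range p, (Nat.choose (p + d) i : ℚ) := by
    have h := two_pow_le_two_mul_sum_choose (p + d) p (by omega)
    exact_mod_cast h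
  have hphiC : (0 : ℚ) ≤ phiK p 3 * (Nat.choose (p + d) 3 : ℚ) :=
    mul_nonneg (phiK_three_nonneg p) (by positivity)
  unfold alphaP at hL
  nlinarith [hL, hPC, hC3, hY, hhalf, hphiC]

/-! ### Regime A, case A3: `p − 1 ≤ d ≤ 3p + 2` -/

/-- Case A3 of THEOREM R3: `RegimeA p d` for `p ≥ 201`, `p ≤ d + 1`, `d ≤ 3p + 2`. -/
theorem regimeA_of_le_three_mul (p d : ℕ) (hp : 201 ≤ p) (hdp : p ≤ d + 1) (hd : d ≤ 3 * p + 2) :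
    RegimeA p d := by
  unfold RegimeA
  rw [sum_range_choose_eq_sub]
  have hn207 : 207 ≤ p + d := by omega
  have hL := lhsU_le p d (by omega)
  have hF2 := phiK_mul_choose_mul_le p (p + d)
  -- `n ≤ 4(p+1)` so `n³ ≤ 64(p+1)³`
  have hratio : ((p + d : ℕ) : ℚ) ≤ 4 * ((p : ℚ) + 1) := by
    have : p + d ≤ 4 * (p + 1) := by omega
    exact_mod_cast this
  have hratio3 : ((p + d : ℕ) : ℚ) ^ 3 ≤ 64 * ((p : ℚ) + 1) ^ 3 := by
    have h := pow_le_pow_left₀ (by positivity) hratio 3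
    calc ((p + d : ℕ) : ℚ) ^ 3 ≤ (4 * ((p : ℚ) + 1)) ^ 3 := h
      _ = 64 * ((p : ℚ) + 1) ^ 3 := by ring
  have hpos : (0 : ℚ) < ((p : ℚ) + 1) ^ 3 := by positivity
  have hPC : phiK p 3 * (Nat.choose (p + d) 3 : ℚ) ≤ (2 : ℚ) ^ (p + 3) * 64 := by
    have h : (phiK p 3 * (Nat.choose (p + d) 3 : ℚ)) * ((p : ℚ) + 1) ^ 3
        ≤ ((2 : ℚ) ^ (p + 3) * 64) * ((p : ℚ) + 1) ^ 3 := by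
      calc (phiK p 3 * (Nat.choose (p + d) 3 : ℚ)) * ((p : ℚ) + 1) ^ 3
          ≤ (2 : ℚ) ^ (p + 3) * ((p + d : ℕ) : ℚ) ^ 3 := hF2
        _ ≤ (2 : ℚ) ^ (p + 3) * (64 * ((p : ℚ) + 1) ^ 3) := by gcongr
        _ = ((2 : ℚ) ^ (p + 3) * 64) * ((p : ℚ) + 1) ^ 3 := by ring
    exact le_of_mul_le_mul_right h hpos
  -- `C(n,3) ≤ n³ ≤ (4p+2)³` and `80·(4p+2)³ ≤ 4^p`
  have hC3 : (Nat.choose (p + d) 3 : ℚ) ≤ ((4 * p + 2 : ℕ) : ℚ) ^ 3 := by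
    have h1 : Nat.choose (p + d) 3 ≤ (p + d) ^ 3 := Nat.choose_le_pow _ _
    have h2 : (p + d) ^ 3 ≤ (4 * p + 2) ^ 3 := Nat.pow_le_pow_left (by omega) 3
    exact_mod_cast h1.trans h2
  have hcube : 80 * ((4 * p + 2 : ℕ) : ℚ) ^ 3 ≤ (4 : ℚ) ^ p := by
    exact_mod_cast eighty_mul_cube_le_four_pow p hp
  -- `2^{p+3}·64·(811/210)·8 ≤ 2^{p+14} ≤ 2^{2p}/2`
  have hexp : (2 : ℚ) ^ (p + 14) * 2 ≤ (4 : ℚ) ^ p := by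
    have : (4 : ℚ) ^ p = 2 ^ (2 * p) := by rw [show (4 : ℚ) = 2 ^ 2 by norm_num, ← pow_mul]
    rw [this]
    have : (2 : ℚ) ^ (p + 14) * 2 = 2 ^ (p + 15) := by ring
    rw [this]
    exact pow_le_pow_right₀ (by norm_num) (by omega)
  have hexp' : (2 : ℚ) ^ (p + 3) * 64 * 8 * 4 = (2 : ℚ) ^ (p + 14) := by ring
  -- the half sum at `2p − 2`, then monotonicity: `2^{2p−2} ≤ 2·Σ_{i<p} C(2p−2,i) ≤ 2·Σ_{i<p} C(p+d,i)`
  have hhalf : (2 : ℚ) ^ (2 * p) ≤ 8 * ∑ i ∈ range p, (Nat.choose (p + d) i : ℚ) := by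
    have h1 := two_pow_le_two_mul_sum_choose (2 * p - 2) p (by omega)
    have h2 := sum_range_choose_mono p (2 * p - 2) (p + d) (by omega)
    have h3 : 2 ^ (2 * p) = 4 * 2 ^ (2 * p - 2) := by
      rw [show 2 * p = (2 * p - 2) + 2 by omega]
      rw [Nat.add_sub_cancel]
      ring
    have h4 : 2 ^ (2 * p) ≤ 8 * ∑ i ∈ range p, Nat.choose (p + d) i := by
      rw [h3]
      omega
    exact_mod_cast h4
  have hfour : (4 : ℚ) ^ p = 2 ^ (2 * p) := by rw [show (4 : ℚ) = 2 ^ 2 by norm_num, ← pow_mul]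
  have hphiC : (0 : ℚ) ≤ phiK p 3 * (Nat.choose (p + d) 3 : ℚ) :=
    mul_nonneg (phiK_three_nonneg p) (by positivity)
  unfold alphaP at hL
  rw [hfour] at hexp hcube
  nlinarith [hL, hPC, hC3, hcube, hexp, hexp', hhalf, hphiC]

/-! ### Regime B′: `d ≥ 3p − 1` -/

/-- THEOREM R3 (B′): `RegimeB p d` for `p ≥ 201` and `3p ≤ d + 1`. -/
theorem regimeB_of_le (p d : ℕ) (hp : 201 ≤ p) (hd : 3 * p ≤ d + 1) : RegimeB p d := by
  unfold RegimeB
  have hn207 : 207 ≤ p + d := by omega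
  have hL := lhsU_le p d (by omega)
  -- `Φ ≤ 2^{p+3}` (crudely, `C(p+3,3) ≥ 1`)
  have hphi_le : phiK p 3 ≤ (2 : ℚ) ^ (p + 3) := by
    have h1 := phiK_three_mul_choose_le p
    have h2 : (1 : ℚ) ≤ (Nat.choose (p + 3) 3 : ℚ) := by
      exact_mod_cast Nat.choose_pos (by omega : 3 ≤ p + 3)
    have hphi := phiK_three_nonneg p
    calc phiK p 3 = phiK p 3 * 1 := by ring
      _ ≤ phiK p 3 * (Nat.choose (p + 3) 3 : ℚ) := mul_le_mul_of_nonneg_left h2 hphi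
      _ ≤ _ := h1
  have hCn : (0 : ℚ) ≤ (Nat.choose (p + d) 3 : ℚ) := by positivity
  -- `L ≤ 2^{p+6}·C(n,3)`
  have hL' : lhsU p d ≤ (2 : ℚ) ^ (p + 6) * (Nat.choose (p + d) 3 : ℚ) := by
    have h1 : phiK p 3 * (Nat.choose (p + d) 3 : ℚ) ≤ (2 : ℚ) ^ (p + 3) * (Nat.choose (p + d) 3 : ℚ) :=
      mul_le_mul_of_nonneg_right hphi_le hCn
    have h2 : (1 : ℚ) ≤ (2 : ℚ) ^ (p + 3) := one_le_pow₀ (by norm_num)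
    have h3 : (2 : ℚ) ^ (p + 6) = 8 * (2 : ℚ) ^ (p + 3) := by ring
    have h4 : (Nat.choose (p + d) 3 : ℚ) ≤ (2 : ℚ) ^ (p + 3) * (Nat.choose (p + d) 3 : ℚ) := by
      nlinarith [h2, hCn]
    rw [h3]
    unfold alphaP at hL
    nlinarith [hL, h1, h4, hCn]
  -- now write `p = k + 4`: `2^{p+6} ≤ 3^k` and `3^k·C(n,3) ≤ C(n,k+3) = C(n,p−1)`
  obtain ⟨k, rfl⟩ : ∃ k, p = k + 4 := ⟨p - 4, by omega⟩
  have h3pow : (2 : ℚ) ^ (k + 4 + 6) ≤ (3 : ℚ) ^ k := by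
    exact_mod_cast two_pow_le_three_pow k (by omega)
  have hgrow : (3 : ℚ) ^ k * (Nat.choose (k + 4 + d) 3 : ℚ) ≤ (Nat.choose (k + 4 + d) (k + 3) : ℚ) := by
    exact_mod_cast three_pow_mul_choose_three_le (k + 4 + d) (k + 4) (by omega) k (le_refl _)
  have hsingle : (Nat.choose (k + 4 + d) (k + 3) : ℚ)
      ≤ ∑ u ∈ Ico 4 (k + 4), (Nat.choose (k + 4 + d) u : ℚ) := by
    apply single_le_sum (f := fun u => (Nat.choose (k + 4 + d) u : ℚ)) (fun _ _ => by positivity)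
    simp only [mem_Ico]
    omega
  calc lhsU (k + 4) d ≤ (2 : ℚ) ^ (k + 4 + 6) * (Nat.choose (k + 4 + d) 3 : ℚ) := hL'
    _ ≤ (3 : ℚ) ^ k * (Nat.choose (k + 4 + d) 3 : ℚ) := mul_le_mul_of_nonneg_right h3pow hCn
    _ ≤ (Nat.choose (k + 4 + d) (k + 3) : ℚ) := hgrow
    _ ≤ _ := hsingle

/-! ### THEOREM R3 -/

/-- THEOREM R3 (A): for every `p ≥ 201` and every `6 ≤ d ≤ 3p + 2`, regime A holds:
`Φ(p,3)·((2+ρ)C(n,3) + n²) + Σ_{j≤3} C(n,j) + (1+ρ)C(n,3) + n² + Σ_{j≤d} C(n,j) ≤ 2ⁿ`, `n = p + d`. -/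
theorem regimeA_of_le (p d : ℕ) (hp : 201 ≤ p) (hd6 : 6 ≤ d) (hd : d ≤ 3 * p + 2) : RegimeA p d := by
  rcases Nat.lt_or_ge d 10 with h9 | h10
  · exact regimeA_of_le_nine p d hp hd6 (by omega)
  · rcases Nat.lt_or_ge (d + 2) (p + 1) with hsmall | hbig
    · exact regimeA_of_le_sub_two p d hp h10 (by omega)
    · exact regimeA_of_le_three_mul p d hp (by omega) hd

/-- THEOREM R3: for every `p ≥ 201` and every `d ≥ 6`, regime A or regime B′ holds at `(p, d)`
(A on `d ≤ 3p + 2`, B′ on `d ≥ 3p − 1`) — residue (R3) of NIGHT-1 §13.4 closed in the kernel. -/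
theorem regime_of_six_le (p d : ℕ) (hp : 201 ≤ p) (hd : 6 ≤ d) : RegimeA p d ∨ RegimeB p d := by
  rcases Nat.lt_or_ge d (3 * p + 3) with h | h
  · exact Or.inl (regimeA_of_le p d hp hd (by omega))
  · exact Or.inr (regimeB_of_le p d hp (by omega))

end CoreRegimes
end PercRepro
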